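import Summits.ResolutionOfSingularities.ResolutionOfSingularities.Theorems.EquisingularLiftEquisingularLiftNatCechVanishingTransfer
import Summits.ResolutionOfSingularities.ResolutionOfSingularities.Theorems.EquisingularLiftEquisingularLiftNatCechTransferPlumbing
import Summits.ResolutionOfSingularities.ResolutionOfSingularities.Theorems.EquisingularLiftEquisingularLiftNatDirLiftQuotientClass
import Summits.ResolutionOfSingularities.ResolutionOfSingularities.Theorems.EquisingularLiftEquisingularLiftNatDirLiftRankAdditive
import Literature.AlgebraicGeometry.HodgeTheory.RegularImmersionConormal
import HarnessLib

/-!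
# [OURS · L1 W4.5(b) · S6 (L) brick C2, B3 ASSEMBLY] `hQ` of `Tower.hLift_of_bricks` from `DirStepUnobs` modulo the bridge (★)

Cell `res-hironaka`, LADDER-RESOLUTION rung L (D-0089), slot W4.5(b), crux chain w45b: working crux
`Theses.EquisingularLift.EquisingularLiftNat` (stmt-ResolutionOfSingularities-20038) / child `EquisingularLiftNatThree`
(stmt-ResolutionOfSingularities-20148); the ONE registered socket at `n = 3` is `stub_elnat_three_liftSections` =
res-L1-w45b-stub-4's `Tower.hLift_of_bricks`, whose brick C2 is the hypothesis

  `hQ : Subsingleton (CechMH1 (ProjCech.toSpec k 1) (sheafHom L₀ Q) (fun i : Fin 2 => ProjCech.Dplus k 1 {i}))`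

(`L₀ = lineBundle (proportionalCocycle …)`, `Q = cokernel ι₀`, res-type-027's cut `Cruxes/EquisingularLiftNatThree/Lines/C2-CENSUS-res-type-027.md`).
This file is the B3 ASSEMBLY of that cut (deal res-type-027 g15 / res-L1-w45b-plan-1, STATUS 2026-08-28T00:03–00:04Z): it derives `hQ`
from the stage's unobstructedness datum `hunobs : DirStepUnobs G E hE Z hZ` and ONE NAMED HYPOTHESIS, res-type-027's bridge (★)
`cechPic_pullback_detClass_conormal_section` in CLASS CURRENCY

  `(★)  CechPic.pullback Φ.hom (detClass 𝒞_{Γ̃₁/Ẽ₁}) * detClass F = detClass L₀ ^ 2`      (in `Ȟ¹(ℙ¹, 𝒪^×)`),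

consuming the landed sub-bricks BY NAME: B0 `dirStepUnobs_transport` (res-L1-w45b-stub-2, p586246) · K1 `isFiniteLocallyFree_sheafHom_of_hasRank_one`
(res-type-027, p585400) · B2 `detClass_sheafHom_eq_of_shortExact` / `hasRank_sheafHom_one_of_shortExact` (res-D-pv-036, p585762) · B2′
`hasRank_X₃_one_of_shortExact` (res-D-pv-036, p587030) · B3-PLUMBING `detClass_dual_eq_inv` / `isFiniteLocallyFree_dual_of_hasRank_one`
(res-L1-w45b-stub-2) · B3-TRANSFER `subsingleton_cechMH1_Dplus_of_iso_of_detClass_eq` (res-L1-w45b-stub-2, p586926).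

Also: `hasRank_conormalSheaf_of_isRegularImmersionOfCodim` — the conormal sheaf of a regular immersion of codimension `p` has rank `p`
(`HasRank` twin of the tree's `IsRegularImmersionOfCodim.isFiniteLocallyFree_conormalSheaf`), for the `hF2` input.

MATHEMATICS (census §1 «Close»). `hunobs` transported along the stage isomorphisms `ε, εZ` (B0) gives `Ȟ¹(V; 𝒩_{Γ̃₁/Ẽ₁}) = 0` on an affine
2-cover `V` of `Γ̃₁`, for the given closed immersion `i₁ : Γ̃₁ ⟶ Ẽ₁`; `𝒩 = 𝒞^∨` has class `[𝒞]⁻¹` (plumbing); on the `Q`-side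
`[𝓗om(L₀, Q)] = [F]·[L₀]⁻²` (B2, with `rk Q = 1` from B2′); (★) says `Φ^*[𝒞]·[F] = [L₀]²`, i.e. `Φ^*[𝒩] = [𝓗om(L₀, Q)]`; equal classes of
rank-one bundles on `ℙ¹` ⇒ isomorphic after transport along `Φ` ⇒ `Ȟ¹` vanishing moves to `𝓗om(L₀, Q)` on ANY affine cover, in particular
the standard `D₊` cover (B3-TRANSFER, cover independence). Stated for an arbitrary short exact sequence `S : 0 → L₀ → F → Q → 0` of finite
locally free modules on `ℙ¹_A` of ranks `1, 2, ·` (stub-4 instantiates `S := ShortComplex.mk ι₀ (cokernel.π ι₀) _`), an arbitrary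
`Φ : ℙ¹_A ≅ Γ̃₁` (stub-4: plumbing `exists_iso_redSub_of_subscheme_eq`) and an arbitrary `i₁` over `G₁` (stub-4 / 027:
`IdealSheafData.inclusion`), so that no C1c object enters this file.

`--supports stmt-ResolutionOfSingularities-20148 --as helper`. OURS; NOT a statement of any manuscript ([Hironaka2017] is a candidate under
adjudication, D-0012/D-0089, nothing of it is asserted here); AI-written, and AI review is weaker than expert review. No `sorry`,
standard axioms, DEF-FREE.

References (index only): R. Hartshorne, *Algebraic Geometry* (1977), II Ex. 5.1 (b), II Ex. 6.8, III Ex. 4.5 [cite: Hartshorne1977];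
The Stacks Project, Tag 01ED [cite: StacksProject].
-/

noncomputable section

-- `TopCat.Presheaf`/`Scheme.Modules` are not reducible (as in Mathlib's `AlgebraicGeometry/Modules`).
set_option backward.isDefEq.respectTransparency false

open CategoryTheory CategoryTheory.Limits AlgebraicGeometry TopologicalSpace Opposite
open Literature.AlgebraicGeometry.Modules Literature.AlgebraicGeometry.Motives
open Literature.AlgebraicGeometry.Morphisms (CechMH1 ProjCech.PP ProjCech.toSpec ProjCech.Dplus)
open Literature.AlgebraicGeometry.Deformation (conormalSheaf idealModule)
open Literature.AlgebraicGeometry.HodgeTheory (normalSheaf IsRegularImmersionOfCodim nonempty_basis_sections_pullback_idealModule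
  coh_conormalSheaf)

set_option linter.dupNamespace false -- mandated namespace `Summit.<Summit>.<Problem>` of this single-conjunct summit

namespace Summit.ResolutionOfSingularities.ResolutionOfSingularities.Cruxes.EquisingularLiftNat.Sections

universe u

/-- **Class bookkeeping of the Euler identification** (census §1 «Close», pure group algebra in `Ȟ¹(ℙ¹, 𝒪^×)`): if
`Φ^*[𝒞]·[F] = [L₀]²` (★), `[𝒩] = [𝒞]⁻¹` and `[H] = [F]·([L₀]²)⁻¹`, then `Φ^*[𝒩] = [H]`. [folklore] -/
theorem cechPic_pullback_eq_of_bridge {X Y : Scheme.{0}} (φ : Y ⟶ X) (c𝒞 c𝒩 : CechPic X) (cF cL cH : CechPic Y)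
    (hstar : CechPic.pullback φ c𝒞 * cF = cL ^ 2) (h𝒩 : c𝒩 = c𝒞⁻¹) (hH : cH = cF * (cL ^ 2)⁻¹) :
    CechPic.pullback φ c𝒩 = cH := by
  rw [h𝒩, map_inv, hH, ← hstar, mul_inv_rev, ← mul_assoc, mul_inv_cancel, one_mul]

/-- **C2 / B3 ASSEMBLY — `hQ` of `Tower.hLift_of_bricks` from `DirStepUnobs` modulo the bridge (★).** For the stage pair `Z ⊆ E` of `G`
with unobstructedness datum `hunobs : DirStepUnobs G E hE Z hZ`, the root round's pair `Γ₁ ⊆ E₁` of `G₁` identified with it by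
isomorphisms `ε : Ẽ ⟶ Ẽ₁`, `εZ : Z̃ ⟶ Γ̃₁` over `ϱ : G ⟶ G₁` (binders of the socket verbatim), a closed immersion `i₁ : Γ̃₁ ⟶ Ẽ₁` over
`G₁` whose conormal sheaf is a LINE bundle, an isomorphism `Φ : ℙ¹_A ≅ Γ̃₁`, and a short exact sequence `S : 0 → L₀ → F → Q → 0` of
finite locally free modules on `ℙ¹_A` with `rk L₀ = 1`, `rk F = 2`: the bridge identity (★) `Φ^*[𝒞_{Γ̃₁/Ẽ₁}]·[F] = [L₀]²` implies
`Ȟ¹(D₊; 𝓗om(L₀, Q)) = 0` on the standard cover of `ℙ¹_A`. PROOF: B0 ⇒ `DirStepUnobs G₁ E₁ Γ₁`, applied to `i₁` ⇒ `Ȟ¹(V; 𝒩) = 0` on an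
affine 2-cover; `[𝒩] = [𝒞]⁻¹` (plumbing), `rk Q = 1` (B2′), `[𝓗om(L₀,Q)] = [F]·[L₀]⁻²` (B2), (★) ⇒ `Φ^*[𝒩] = [𝓗om(L₀,Q)]`
(`cechPic_pullback_eq_of_bridge`) ⇒ B3-TRANSFER. [OURS · L1 W4.5b · C2/B3 assembly; replaces nothing printed; NOT a statement of the
manuscript] [cite: Hartshorne1977, III Ex. 4.5] -/
theorem subsingleton_cechMH1_sheafHom_Dplus_of_dirStepUnobs {A : Type} [CommRing A]
    -- the stage `(G ⊇ E ⊇ Z)` and the root round `(G₁ ⊇ E₁ ⊇ Γ₁)` with the isomorphisms `ε`, `εZ` (B0's binders verbatim)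
    (G : Scheme.{0}) (E : Set G) (hE : IsClosed E) (Z : Set G) (hZ : IsClosed Z)
    (G₁ : Scheme.{0}) (ϱ : G ⟶ G₁) (E₁ : Set G₁) (hE₁ : IsClosed E₁) (Γ₁ : Set G₁) (hΓ₁ : IsClosed Γ₁)
    (ε : redSub G E hE ⟶ redSub G₁ E₁ hE₁) (εZ : redSub G Z hZ ⟶ redSub G₁ Γ₁ hΓ₁)
    (hZE : Z ⊆ E) (hΓE : Γ₁ ⊆ E₁)
    (hεiso : IsIso ε) (hεcomm : ε ≫ redSubι G₁ E₁ hE₁ = redSubι G E hE ≫ ϱ)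
    (hεZiso : IsIso εZ) (hεZcomm : εZ ≫ redSubι G₁ Γ₁ hΓ₁ = redSubι G Z hZ ≫ ϱ)
    (hunobs : DirStepUnobs G E hE Z hZ)
    -- the closed immersion `i₁ : Γ̃₁ ⟶ Ẽ₁` over `G₁` and its conormal LINE bundle (B1b/B1c frames)
    (i₁ : redSub G₁ Γ₁ hΓ₁ ⟶ redSub G₁ E₁ hE₁) (hi₁ : i₁ ≫ redSubι G₁ E₁ hE₁ = redSubι G₁ Γ₁ hΓ₁)
    (h𝒞f : IsFiniteLocallyFree (conormalSheaf i₁)) (h𝒞1 : HasRank (conormalSheaf i₁) 1)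
    -- the identification `Φ : ℙ¹_A ≅ Γ̃₁` (plumbing `exists_iso_redSub_of_subscheme_eq`)
    (Φ : ProjCech.PP A 1 ≅ redSub G₁ Γ₁ hΓ₁)
    -- the `Q`-side: `0 → L₀ → F → Q → 0` on `ℙ¹_A`
    {S : ShortComplex (ProjCech.PP A 1).Modules} (hS : S.ShortExact)
    (hL₀f : IsFiniteLocallyFree S.X₁) (hL₀1 : HasRank S.X₁ 1)
    (hFf : IsFiniteLocallyFree S.X₂) (hF2 : HasRank S.X₂ 2) (hQf : IsFiniteLocallyFree S.X₃)
    -- (★) res-type-027's bridge `cechPic_pullback_detClass_conormal_section`, taken by name as a hypothesis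
    (hstar : CechPic.pullback Φ.hom (detClass h𝒞f) * detClass hFf = detClass hL₀f ^ 2) :
    Subsingleton (CechMH1 (ProjCech.toSpec A 1) (sheafHom S.X₁ S.X₃) (fun j : Fin 2 => ProjCech.Dplus A 1 {j})) := by
  -- B0: the unobstructedness datum on the root round, for THIS `i₁`
  have hunobs₁ : DirStepUnobs G₁ E₁ hE₁ Γ₁ hΓ₁ :=
    dirStepUnobs_transport G E hE Z hZ G₁ ϱ E₁ hE₁ Γ₁ hΓ₁ ε εZ hZE hΓE hεiso hεcomm hεZiso hεZcomm hunobs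
  obtain ⟨V, hVaff, -, hVtop, hN⟩ := hunobs₁ i₁ hi₁
  -- the normal LINE bundle `𝒩 = 𝒞^∨` and its class `[𝒩] = [𝒞]⁻¹`
  have hNf : IsFiniteLocallyFree (normalSheaf i₁) := isFiniteLocallyFree_dual_of_hasRank_one h𝒞1
  obtain ⟨hN1, hNcl⟩ := detClass_dual_eq_inv h𝒞1 h𝒞f hNf
  -- the `Q`-side: `rk Q = 1` (B2′), `𝓗om(L₀, Q)` is a line bundle of class `[F]·[L₀]⁻²` (K1, B2)
  have hQ1 : HasRank S.X₃ 1 := hasRank_X₃_one_of_shortExact hS hL₀1 hF2 hQf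
  have hHf : IsFiniteLocallyFree (sheafHom S.X₁ S.X₃) := isFiniteLocallyFree_sheafHom_of_hasRank_one hL₀1 hQ1
  have hH1 : HasRank (sheafHom S.X₁ S.X₃) 1 := hasRank_sheafHom_one_of_shortExact hL₀1 hQ1 hL₀f hQf
  have hHcl : detClass hHf = detClass hFf * (detClass hL₀f ^ 2)⁻¹ :=
    detClass_sheafHom_eq_of_shortExact hS hL₀1 hQ1 hL₀f hFf hQf hHf
  -- (★) ⇒ `Φ^*[𝒩] = [𝓗om(L₀, Q)]`
  have hcl : CechPic.pullback Φ.hom (detClass hNf) = detClass hHf :=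
    cechPic_pullback_eq_of_bridge Φ.hom (detClass h𝒞f) (detClass hNf) (detClass hFf) (detClass hL₀f) (detClass hHf)
      hstar hNcl hHcl
  -- B3-TRANSFER
  exact subsingleton_cechMH1_Dplus_of_iso_of_detClass_eq Φ (redSub G₁ Γ₁ hΓ₁).toSpecΓ hNf hN1 V hVaff hVtop hN hHf hH1 hcl

/-- **The conormal sheaf of a regular immersion of codimension `p` has rank `p`** (Görtz–Wedhorn II, Rem. 19.22 with Def. 19.21 (b):
`𝒞_i = i^*(𝓘/𝓘²)` is locally free of rank the length of the regular sequence): the `HasRank` twin of the tree's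
`IsRegularImmersionOfCodim.isFiniteLocallyFree_conormalSheaf` (same charts `i⁻¹V`, same bases of the chart sections, assembled into a
`FrameSystem` of constant rank `p`); with `p = 2` and `hasRank_pullback` (res-D-pv-036) it yields the input `hF2 : HasRank (g^* e⁻¹^* 𝒞_{V(I)}) 2`
of the assembly at stub-4's call site. [cite: GortzWedhorn2023, Rem. 19.22 with Def. 19.21 (b)] -/
theorem hasRank_conormalSheaf_of_isRegularImmersionOfCodim {X Z : Scheme.{u}} {i : Z ⟶ X} [IsLocallyNoetherian X] {p : ℕ}
    (h : IsRegularImmersionOfCodim i p) : HasRank (conormalSheaf i) p := by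
  haveI : IsClosedImmersion i := h.isClosedImmersion
  have hfr : ∀ z : Z, ∃ (W : Z.Opens) (_ : z ∈ W), Nonempty (SheafOfModules.free (ULift.{u} (Fin p)) ≅ (conormalSheaf i).over W) := by
    intro z
    obtain ⟨V, hzV, rs, hlen, hreg, hI⟩ := h.2 z
    have hofFn : List.ofFn rs.get = rs := List.ofFn_get rs
    have hrange : Ideal.span (Set.range rs.get) = i.ker.ideal V := by
      rw [Set.range_list_get, ← hI, Ideal.ofList]
    have hreg' : RingTheory.Sequence.IsWeaklyRegular Γ(X, (V : X.Opens)) (List.ofFn rs.get) := by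
      rw [hofFn]
      exact hreg
    obtain ⟨b⟩ := nonempty_basis_sections_pullback_idealModule i V rs.get hreg' hrange
    refine ⟨i ⁻¹ᵁ (V : X.Opens), hzV, ?_⟩
    have e : Fin rs.length ≃ ULift.{u} (Fin p) := (finCongr hlen).trans Equiv.ulift.symm
    exact nonempty_free_iso_over_of_basis _ (coh_conormalSheaf i).loc (V.2.preimage i) (b.reindex e)
  choose W hzW hW using hfr
  let F : FrameSystem (conormalSheaf i) :=
    { U := W
      mem := hzW
      I := fun _ => ULift.{u} (Fin p)
      rank := fun _ => p
      enum := fun _ => Equiv.ulift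
      frame := fun z => (hW z).some }
  exact F.hasRank p fun _ => rfl

end Summit.ResolutionOfSingularities.ResolutionOfSingularities.Cruxes.EquisingularLiftNat.Sections

end
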